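import Literature.AlgebraicTopology.SingularHomology.PairTimesInterval
import Literature.AlgebraicTopology.SingularHomology.CellsAttachmentEuler
import Mathlib.Analysis.Normed.Group.AddCircle
import Mathlib.Topology.UnitInterval
import HarnessLib

/-!
# The product `S¹ × K`: finiteness of homology and `χ(S¹ × K) = 0`; the cylinder `I × K`

Topic `Literature/AlgebraicTopology/SingularHomology`, companion of `PairTimesInterval.lean`.
For a space `K` whose singular homology (coefficients `M` over `R`) is finitely generated and
vanishes from degree `N` on (`FinRelHomology R M K ∅ N`) we prove:

* `FinRelHomology.unitInterval_prod` — the cylinder `I × K` has finitely generated homology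
  bounded by `N` and **`χ(I × K) = χ(K)`** (the pair `(I × K, {0} × K)` is acyclic,
  `isZero_relativeSingularHomology_tubeZero`, and `{0} × K ≅ K`; exact sequence of the pair);
* `relativeSingularHomology.nonempty_circlePairIso` —
  **`Hₙ(I × K, {0,1} × K) ≅ Hₙ(S¹ × K, D × K)`** for a closed arc `D ⊂ S¹ = ℝ/ℤ` (excise a
  thinner open arc, Hatcher Thm. 2.20; straighten the remaining fat arc to an interval and retract
  its two collars onto the end points of its core, Prop. 2.19);
* **`FinRelHomology.addCircle_prod`** — `S¹ × K` (with `S¹ = AddCircle 1 = ℝ/ℤ`) has finitely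
  generated homology bounded by `N + 1` and **`χ(S¹ × K) = 0`**: by the exact sequence of the pair
  `(S¹ × K, D × K)`, `χ(S¹ × K) = χ(D × K) + χ(S¹ × K, D × K) = χ(K) + χ(I × K, {0,1} × K) =
  χ(K) - χ(K)` (`FinRelHomology.prod_unitInterval`: `χ((K, ∅) × (I, ∂I)) = -χ(K)`);
  `FinRelHomology.prod_addCircle` (factors swapped) and `FinRelHomology.addCircle_prod_of_ne_zero`
  (any period) are the variants;
* §4: the absolute cases **`χ(S¹) = 0`**, **`χ(T²) = 0`** and `χ(K × T²) = 0`
  (`FinRelHomology.unitAddCircle`, `FinRelHomology.unitAddCircle_prod_unitAddCircle`,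
  `FinRelHomology.prod_torus`), from `K = point` (`finRelHomology_empty_of_contractibleSpace`).

This is the Euler-characteristic bookkeeping "`χ(F × S¹) = χ(F) · χ(S¹) = 0`" (Spanier 1981,
Ch. 9, Sec. 3, Thm. 1 for the trivial bundle; Hatcher 2002, the Künneth formula, Cor. 3B.7)
obtained, as in `PairTimesInterval.lean`, without products in homology and without any hypothesis
on `K` beyond finiteness of its homology — the form in which it enters cut-and-paste constructions
of manifolds along hypersurfaces `Σ × S¹` (the gluing region of a normal connected sum,
Gompf–Stipsicz 1999, §10.2; Akhmedov–Park 2010, §9, proof of Lemma 8: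
"`e(X₁(m)) = e(Y₁(1,1)) + e(Z''(1,m)) - 2e(Σ₂)`").  Everything is proved; there are no named facts
and no new notions: the homeomorphisms used (arcs of `ℝ/ℤ` with intervals, re-subtypings, the
straight-line retraction of the fat arc onto its core) are built inside the proofs, the arcs being
provided as existence statements with their pointwise description (`exists_arcHomeomorph`).

## References

* A. Hatcher, *Algebraic Topology*, CUP (2002), §2.1 Prop. 2.19 (homotopy invariance for pairs),
  Thm. 2.20 (excision), p. 118 (exact sequence of a triple); §2.2 Thm. 2.44 (Euler
  characteristic along exact sequences). [HatcherAT2002]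
* E. H. Spanier, *Algebraic Topology*, Springer (1981), Ch. 4, Sec. 3 (Euler characteristic);
  Ch. 9, Sec. 3, Thm. 1 (`χ(E) = χ(B)χ(F)`). [Spanier1981]
-/

noncomputable section

open CategoryTheory Limits Set unitInterval Metric

universe u v

namespace Literature.AlgebraicTopology.SingularHomology

/-! ### §0 Arcs of the circle `ℝ/ℤ` -/

section Arcs

/-- On `ℝ/ℤ`, `‖[x]‖ = |x|` as soon as `|x| ≤ ½` (Mathlib's `AddCircle.norm_coe_eq_abs_iff`).
[folklore] -/
theorem norm_coe_eq_abs_unitAddCircle {x : ℝ} (hx : |x| ≤ 1 / 2) :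
    ‖((x : ℝ) : AddCircle (1 : ℝ))‖ = |x| :=
  (AddCircle.norm_coe_eq_abs_iff (1 : ℝ) one_ne_zero).2 (by rwa [abs_one])

/-- On `ℝ/ℤ`, `dist [x] [y] = |x - y|` as soon as `|x - y| ≤ ½`. [folklore] -/
theorem dist_coe_unitAddCircle_eq_abs {x y : ℝ} (h : |x - y| ≤ 1 / 2) :
    dist ((x : ℝ) : AddCircle (1 : ℝ)) ((y : ℝ) : AddCircle (1 : ℝ)) = |x - y| := by
  rw [dist_eq_norm, ← AddCircle.coe_sub, norm_coe_eq_abs_unitAddCircle h]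

/-- **The half-turn identity on `ℝ/ℤ`**: `‖θ - [½]‖ = ½ - ‖θ‖` (the distances from a point of a
circle of circumference `1` to two antipodal points add up to `½`). [folklore] -/
theorem norm_sub_coe_half_unitAddCircle (θ : AddCircle (1 : ℝ)) :
    ‖θ - ((1 / 2 : ℝ) : AddCircle (1 : ℝ))‖ = 1 / 2 - ‖θ‖ := by
  haveI : Fact ((0 : ℝ) < 1) := ⟨one_pos⟩
  obtain ⟨x, hx, rfl⟩ :
      ∃ x ∈ Ico (-(1 / 2 : ℝ)) (-(1 / 2 : ℝ) + 1), ((x : ℝ) : AddCircle (1 : ℝ)) = θ :=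
    ⟨(AddCircle.equivIco (1 : ℝ) (-(1 / 2 : ℝ)) θ : ℝ), (AddCircle.equivIco 1 _ θ).2,
      AddCircle.coe_equivIco⟩
  have hxabs : |x| ≤ 1 / 2 := abs_le.2 ⟨hx.1, by linarith [hx.2]⟩
  rw [norm_coe_eq_abs_unitAddCircle hxabs, ← AddCircle.coe_sub]
  rcases le_or_gt 0 x with h0 | h0
  · rw [norm_coe_eq_abs_unitAddCircle (abs_le.2 ⟨by linarith, by linarith [hx.2]⟩),
      abs_of_nonneg h0, abs_of_nonpos (by linarith [hx.2])]
    ring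
  · have hper :
        (((x - 1 / 2 : ℝ)) : AddCircle (1 : ℝ)) = (((x + 1 / 2 : ℝ)) : AddCircle (1 : ℝ)) := by
      rw [← AddCircle.coe_add_period 1 (x - 1 / 2)]
      congr 1
      ring
    rw [hper, norm_coe_eq_abs_unitAddCircle (abs_le.2 ⟨by linarith [hx.1], by linarith⟩),
      abs_of_neg h0, abs_of_nonneg (by linarith [hx.1])]
    ring

/-- A point of `[c - r, c + r]` projects into the closed arc of radius `r ≤ ½` around `[c]`.
[folklore] -/
theorem coe_mem_closedBall_unitAddCircle {c r : ℝ} (hr : r ≤ 1 / 2) {t : ℝ}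
    (ht : t ∈ Icc (c - r) (c + r)) :
    ((t : ℝ) : AddCircle (1 : ℝ)) ∈ closedBall ((c : ℝ) : AddCircle (1 : ℝ)) r := by
  have h1 : |t - c| ≤ r := abs_sub_le_iff.2 ⟨by linarith [ht.2], by linarith [ht.1]⟩
  rw [mem_closedBall, dist_coe_unitAddCircle_eq_abs (h1.trans hr)]
  exact h1

/-- The projection `ℝ → ℝ/ℤ` is injective on every closed interval of length `< 1`
(Mathlib's `AddCircle.coe_eq_coe_iff_of_mem_Ico`). [folklore] -/
theorem injOn_coe_unitAddCircle_Icc {a b : ℝ} (h : b - a < 1) :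
    InjOn (fun t : ℝ => ((t : ℝ) : AddCircle (1 : ℝ))) (Icc a b) := by
  haveI : Fact ((0 : ℝ) < 1) := ⟨one_pos⟩
  intro x hx y hy hxy
  have hx' : x ∈ Ico a (a + 1) := ⟨hx.1, by linarith [hx.2]⟩
  have hy' : y ∈ Ico a (a + 1) := ⟨hy.1, by linarith [hy.2]⟩
  exact (AddCircle.coe_eq_coe_iff_of_mem_Ico hx' hy').1 hxy

/-- Every point of the closed arc of radius `r` around `[c]` lifts to `[c - r, c + r]`.
[folklore] -/
theorem exists_coe_eq_of_mem_closedBall_unitAddCircle {c r : ℝ} {θ : AddCircle (1 : ℝ)}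
    (hθ : θ ∈ closedBall ((c : ℝ) : AddCircle (1 : ℝ)) r) :
    ∃ t ∈ Icc (c - r) (c + r), ((t : ℝ) : AddCircle (1 : ℝ)) = θ := by
  haveI : Fact ((0 : ℝ) < 1) := ⟨one_pos⟩
  obtain ⟨x, hx, rfl⟩ : ∃ x ∈ Ico (c - 1 / 2) (c - 1 / 2 + 1), ((x : ℝ) : AddCircle (1 : ℝ)) = θ :=
    ⟨(AddCircle.equivIco (1 : ℝ) (c - 1 / 2) θ : ℝ), (AddCircle.equivIco 1 _ θ).2,
      AddCircle.coe_equivIco⟩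
  have hxc : |x - c| ≤ 1 / 2 := abs_sub_le_iff.2 ⟨by linarith [hx.2], by linarith [hx.1]⟩
  rw [mem_closedBall, dist_coe_unitAddCircle_eq_abs hxc] at hθ
  obtain ⟨h1, h2⟩ := abs_sub_le_iff.1 hθ
  exact ⟨x, ⟨by linarith, by linarith⟩, rfl⟩

/-- **The closed arc of radius `r < ½` around `[c]` in `ℝ/ℤ` is homeomorphic to `[c - r, c + r]`
through `t ↦ [t]`** (a continuous bijection from a compact space to a Hausdorff space).
[folklore] -/
theorem exists_arcHomeomorph (c r : ℝ) (hr : r < 1 / 2) :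
    ∃ e : ↥(Icc (c - r) (c + r)) ≃ₜ ↥(closedBall ((c : ℝ) : AddCircle (1 : ℝ)) r),
      ∀ t, ((e t : ↥(closedBall ((c : ℝ) : AddCircle (1 : ℝ)) r)) : AddCircle (1 : ℝ)) =
        ((t : ℝ) : AddCircle (1 : ℝ)) := by
  let f : ↥(Icc (c - r) (c + r)) ≃ ↥(closedBall ((c : ℝ) : AddCircle (1 : ℝ)) r) :=
    Equiv.ofBijective
      (fun t => ⟨((t : ℝ) : AddCircle (1 : ℝ)), coe_mem_closedBall_unitAddCircle hr.le t.2⟩)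
      ⟨fun s t hst => Subtype.ext
          (injOn_coe_unitAddCircle_Icc (by linarith) s.2 t.2 (congrArg Subtype.val hst)),
        fun θ => by
          obtain ⟨t, ht, hθ⟩ := exists_coe_eq_of_mem_closedBall_unitAddCircle θ.2
          exact ⟨⟨t, ht⟩, Subtype.ext hθ⟩⟩
  have hf : Continuous f := by
    show Continuous fun t : ↥(Icc (c - r) (c + r)) =>
      (⟨((t : ℝ) : AddCircle (1 : ℝ)), coe_mem_closedBall_unitAddCircle hr.le t.2⟩ :
        ↥(closedBall ((c : ℝ) : AddCircle (1 : ℝ)) r))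
    exact ((AddCircle.continuous_mk' (1 : ℝ)).comp continuous_subtype_val).subtype_mk _
  exact ⟨Continuous.homeoOfEquivCompactToT2 hf, fun t => rfl⟩

/-- **On the fat arc `[⅛, ⅞]` the norm of `ℝ/ℤ` is `‖[t]‖ = ½ - |t - ½|`.** [folklore] -/
theorem norm_coe_unitAddCircle_of_mem_fatArc {t : ℝ}
    (ht : t ∈ Icc (1 / 8 : ℝ) (7 / 8)) : ‖((t : ℝ) : AddCircle (1 : ℝ))‖ = 1 / 2 - |t - 1 / 2| := by
  have h := norm_sub_coe_half_unitAddCircle ((t : ℝ) : AddCircle (1 : ℝ))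
  rw [← AddCircle.coe_sub, norm_coe_eq_abs_unitAddCircle
    (abs_sub_le_iff.2 ⟨by linarith [ht.2], by linarith [ht.1]⟩)] at h
  linarith

/-- The complement of the open arc of radius `⅛` around `0` is the closed arc of radius `⅜`
around `[½]`. [folklore] -/
theorem compl_ball_zero_eq_closedBall_half_unitAddCircle :
    (ball (0 : AddCircle (1 : ℝ)) (1 / 8))ᶜ =
      closedBall (((1 / 2 : ℝ)) : AddCircle (1 : ℝ)) (3 / 8) := by
  ext θ
  rw [mem_compl_iff, mem_ball, dist_zero_right, not_lt, mem_closedBall, dist_eq_norm,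
    norm_sub_coe_half_unitAddCircle]
  constructor <;> intro h <;> linarith

/-- A point of the fat arc projects outside the open arc of radius `⅛` around `0`. [folklore] -/
theorem coe_notMem_ball_of_mem_fatArc {t : ℝ} (ht : t ∈ Icc (1 / 8 : ℝ) (7 / 8)) :
    ((t : ℝ) : AddCircle (1 : ℝ)) ∉ ball (0 : AddCircle (1 : ℝ)) (1 / 8) := by
  have h : ((t : ℝ) : AddCircle (1 : ℝ)) ∈ (ball (0 : AddCircle (1 : ℝ)) (1 / 8))ᶜ := by
    rw [compl_ball_zero_eq_closedBall_half_unitAddCircle]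
    exact coe_mem_closedBall_unitAddCircle (by norm_num)
      (⟨by linarith [ht.1], by linarith [ht.2]⟩ : t ∈ Icc (1 / 2 - 3 / 8 : ℝ) (1 / 2 + 3 / 8))
  exact h

end Arcs

/-! ### §1 The cylinder `I × K` -/

section Cylinder

variable (R : Type v) [CommRing R] (M : Type v) [AddCommGroup M] [Module R M]
variable {K : Type u} [TopologicalSpace K]

/-- The slice `{0} × K` of the cylinder `I × K` is a copy of `K`. [folklore] -/
theorem nonempty_sliceZeroHomeomorph :
    Nonempty (K ≃ₜ ↥(Prod.fst ⁻¹' ({0} : Set I) : Set (I × K))) :=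
  ⟨{ toFun := fun x => ⟨((0 : I), x), (rfl : (0 : I) = 0)⟩
     invFun := fun q => q.1.2
     left_inv := fun _ => rfl
     right_inv := fun q => by
       obtain ⟨⟨t, x⟩, ht⟩ := q
       have ht' : t = 0 := ht
       subst ht'
       rfl
     continuous_toFun := (continuous_const.prodMk continuous_id).subtype_mk _
     continuous_invFun := continuous_snd.comp continuous_subtype_val }⟩

variable [IsNoetherianRing R] [HasRankNullity.{max u v} R]

/-- **The cylinder: `H_•(I × K)` is finitely generated and bounded like `H_•(K)`, and
`χ(I × K) = χ(K)`.**  The pair `(I × K, {0} × K)` is acyclic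
(`isZero_relativeSingularHomology_tubeZero`: the slice is a deformation retract, Hatcher 2002,
Cor. 2.11) and `{0} × K ≅ K`; the exact sequence of the pair (p. 118) and additivity of `χ` along
it (Thm. 2.44) give the claim. [cite: HatcherAT2002, §2.1 Cor. 2.11 and p. 118; §2.2 Thm. 2.44] -/
theorem FinRelHomology.unitInterval_prod {N : ℕ} (h : FinRelHomology R M K ∅ N) :
    FinRelHomology R M (I × K) ∅ N ∧ relEuler R M (I × K) ∅ = relEuler R M K ∅ := by
  haveI : Nontrivial R := nontrivial_of_hasRankNullity.{max u v} R
  obtain ⟨e⟩ := nonempty_sliceZeroHomeomorph (K := K)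
  have hset : (Prod.fst ⁻¹' ({0} : Set I) ∪ Prod.snd ⁻¹' (∅ : Set K) : Set (I × K)) =
      Prod.fst ⁻¹' ({0} : Set I) := by
    rw [Set.preimage_empty, Set.union_empty]
  have hzero : ∀ k, IsZero (relativeSingularHomology R M (I × K)
      (Prod.fst ⁻¹' ({0} : Set I) : Set (I × K)) k) := fun k => by
    rw [← hset]
    exact isZero_relativeSingularHomology_tubeZero R M (K := K) ∅ k
  have hXA : FinRelHomology R M (I × K) (Prod.fst ⁻¹' ({0} : Set I) : Set (I × K)) N :=
    (FinRelHomology.of_isZero hzero).mono (Nat.zero_le N)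
  have hAB : FinRelHomology R M (↥(Prod.fst ⁻¹' ({0} : Set I) : Set (I × K)))
      (Subtype.val ⁻¹' (∅ : Set (I × K))) N :=
    h.of_homeomorph e (fun _ hx => False.elim hx) (fun _ hx => False.elim hx)
  obtain ⟨hX, hχ⟩ := FinRelHomology.triple_mid (Set.empty_subset _) hAB hXA
  refine ⟨hX, ?_⟩
  rw [hχ, relEuler_eq_zero_of_isZero hzero, add_zero]
  exact (relEuler_eq_of_homeomorph (R := R) (M := M) (A := (∅ : Set K)) e
    (fun _ hx => False.elim hx) (fun _ hx => False.elim hx)).symm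

end Cylinder

/-! ### §2 `(S¹ × K, D × K)` has the homology of `(I × K, ∂I × K)`

Notation of this section (written out in the statements, `S¹ = AddCircle 1 = ℝ/ℤ`):
`J = [⅛, ⅞] ⊂ ℝ` is the *fat arc*, straightened; inside `J × K`, the *core strip* is
`{¼ ≤ t ≤ ¾}` and the *collar strip* is `{t ≤ ¼} ∪ {¾ ≤ t}`; inside `S¹ × K`, the *thin strip*
is `B × K` with `B = ball 0 ⅛` (open arc) and the *quarter strip* is `D × K` with
`D = closedBall 0 ¼` (closed arc). -/

section CirclePair

variable (R : Type v) [CommRing R] (M : Type v) [AddCommGroup M] [Module R M]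
variable {K : Type u} [TopologicalSpace K]

/-- The complement of the open arc of radius `⅛` around `0` is the closed arc with end points
`[⅛]`, `[⅞]`. [folklore] -/
theorem compl_ball_zero_eq_closedBall_fatArc_unitAddCircle :
    (ball (0 : AddCircle (1 : ℝ)) (1 / 8))ᶜ =
      closedBall ((((1 / 8 + 7 / 8) / 2 : ℝ)) : AddCircle (1 : ℝ)) ((7 / 8 - 1 / 8) / 2) := by
  rw [show ((1 / 8 + 7 / 8) / 2 : ℝ) = 1 / 2 by norm_num, show ((7 / 8 - 1 / 8) / 2 : ℝ) = 3 / 8 by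
    norm_num]
  exact compl_ball_zero_eq_closedBall_half_unitAddCircle

omit [TopologicalSpace K] in
/-- A point of `(S¹ × K) ∖ (B × K)` (`B` the open `⅛`-arc around `0`) has its first coordinate in
the closed arc with end points `[⅛]`, `[⅞]`. [folklore] -/
theorem fst_mem_closedBall_of_mem_compl_thinStrip
    (q : ↥(Prod.fst ⁻¹' ball (0 : AddCircle (1 : ℝ)) (1 / 8) : Set (AddCircle (1 : ℝ) × K))ᶜ) :
    q.1.1 ∈ closedBall ((((1 / 8 + 7 / 8) / 2 : ℝ)) : AddCircle (1 : ℝ)) ((7 / 8 - 1 / 8) / 2) := by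
  rw [← compl_ball_zero_eq_closedBall_fatArc_unitAddCircle]
  exact q.2

omit [TopologicalSpace K] in
/-- Under the straightening `t ↦ [t]` the collar strip corresponds to the quarter strip: for
`t ∈ [⅛, ⅞]`, `t ≤ ¼ ∨ ¾ ≤ t ↔ ‖[t]‖ ≤ ¼`. [folklore] -/
theorem mem_collarStrip_iff_norm (q : ↥(Icc (1 / 8 : ℝ) (7 / 8)) × K) :
    q ∈ ((fun q => (q.1 : ℝ)) ⁻¹' (Iic (1 / 4) ∪ Ici (3 / 4)) :
        Set (↥(Icc (1 / 8 : ℝ) (7 / 8)) × K)) ↔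
      ‖(((q.1 : ℝ)) : AddCircle (1 : ℝ))‖ ≤ 1 / 4 := by
  rw [norm_coe_unitAddCircle_of_mem_fatArc q.1.2]
  show ((q.1 : ℝ) ≤ 1 / 4 ∨ 3 / 4 ≤ (q.1 : ℝ)) ↔ 1 / 2 - |(q.1 : ℝ) - 1 / 2| ≤ 1 / 4
  constructor
  · rintro (h | h)
    · rw [abs_of_nonpos (by linarith)]
      linarith
    · rw [abs_of_nonneg (by linarith)]
      linarith
  · intro h
    rcases le_or_gt ((q.1 : ℝ) - 1 / 2) 0 with h' | h'
    · left
      rw [abs_of_nonpos h'] at h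
      linarith
    · right
      rw [abs_of_pos h'] at h
      linarith

/-- **Straightening the fat arc**: a homeomorphism `[⅛, ⅞] × K ≅ (S¹ × K) ∖ (B × K)` (`B` the
open arc of radius `⅛` around `0`), namely `(t, x) ↦ ([t], x)`, carrying the collar strip
`([⅛, ¼] ∪ [¾, ⅞]) × K` onto `(D ∖ B) × K` (`D` the closed arc of radius `¼`) and back.
[folklore] -/
theorem exists_fatArcStripHomeomorph :
    ∃ Φ : ↥(Icc (1 / 8 : ℝ) (7 / 8)) × K ≃ₜ
        ↥(Prod.fst ⁻¹' ball (0 : AddCircle (1 : ℝ)) (1 / 8) : Set (AddCircle (1 : ℝ) × K))ᶜ,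
      MapsTo Φ ((fun q => (q.1 : ℝ)) ⁻¹' (Iic (1 / 4) ∪ Ici (3 / 4)))
          (Subtype.val ⁻¹' (Prod.fst ⁻¹' closedBall (0 : AddCircle (1 : ℝ)) (1 / 4))) ∧
        MapsTo Φ.symm (Subtype.val ⁻¹' (Prod.fst ⁻¹' closedBall (0 : AddCircle (1 : ℝ)) (1 / 4)))
          ((fun q => (q.1 : ℝ)) ⁻¹' (Iic (1 / 4) ∪ Ici (3 / 4))) := by
  obtain ⟨arc, harc⟩ :=
    exists_arcHomeomorph ((1 / 8 + 7 / 8) / 2) ((7 / 8 - 1 / 8) / 2) (by norm_num)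
  -- read `arc` on `[⅛, ⅞]` literally
  have hJ : Icc ((1 / 8 + 7 / 8) / 2 - (7 / 8 - 1 / 8) / 2 : ℝ)
      ((1 / 8 + 7 / 8) / 2 + (7 / 8 - 1 / 8) / 2) = Icc (1 / 8 : ℝ) (7 / 8) := by
    norm_num
  let arc' : ↥(Icc (1 / 8 : ℝ) (7 / 8)) ≃ₜ
      ↥(closedBall ((((1 / 8 + 7 / 8) / 2 : ℝ)) : AddCircle (1 : ℝ)) ((7 / 8 - 1 / 8) / 2)) :=
    (Homeomorph.setCongr hJ).symm.trans arc
  have harc' : ∀ t,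
      ((arc' t : ↥(closedBall _ _)) : AddCircle (1 : ℝ)) = ((t : ℝ) : AddCircle (1 : ℝ)) :=
    fun t => harc _
  have harc'' : ∀ θ, ((((arc'.symm θ) : ↥(Icc (1 / 8 : ℝ) (7 / 8))) : ℝ) : AddCircle (1 : ℝ)) = θ :=
    fun θ => by rw [← harc' (arc'.symm θ), Homeomorph.apply_symm_apply]
  let Φ : ↥(Icc (1 / 8 : ℝ) (7 / 8)) × K ≃ₜ
      ↥(Prod.fst ⁻¹' ball (0 : AddCircle (1 : ℝ)) (1 / 8) : Set (AddCircle (1 : ℝ) × K))ᶜ :=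
    { toFun := fun q => ⟨((((q.1 : ℝ)) : AddCircle (1 : ℝ)), q.2),
        coe_notMem_ball_of_mem_fatArc q.1.2⟩
      invFun := fun q => (arc'.symm ⟨q.1.1, fst_mem_closedBall_of_mem_compl_thinStrip q⟩, q.1.2)
      left_inv := fun q => by
        refine Prod.ext (Subtype.ext ?_) rfl
        refine injOn_coe_unitAddCircle_Icc (by norm_num) (Subtype.prop _) q.1.2 ?_
        exact harc'' _
      right_inv := fun q => Subtype.ext (Prod.ext (harc'' _) rfl)
      continuous_toFun :=
        (((AddCircle.continuous_mk' (1 : ℝ)).comp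
          (continuous_subtype_val.comp continuous_fst)).prodMk continuous_snd).subtype_mk _
      continuous_invFun :=
        (arc'.symm.continuous.comp ((continuous_fst.comp continuous_subtype_val).subtype_mk
          _)).prodMk (continuous_snd.comp continuous_subtype_val) }
  have hΦ' : ∀ q, ((((Φ.symm q).1 : ℝ)) : AddCircle (1 : ℝ)) = q.1.1 := fun q => harc'' _
  refine ⟨Φ, fun q hq => ?_, fun q hq => ?_⟩
  · show (((q.1 : ℝ)) : AddCircle (1 : ℝ)) ∈ closedBall (0 : AddCircle (1 : ℝ)) (1 / 4)
    rw [mem_closedBall, dist_zero_right]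
    exact (mem_collarStrip_iff_norm q).1 hq
  · rw [mem_collarStrip_iff_norm, hΦ']
    have hq' : q.1.1 ∈ closedBall (0 : AddCircle (1 : ℝ)) (1 / 4) := hq
    rwa [mem_closedBall, dist_zero_right] at hq'

/-- `clamp t ≤ ¾` for the clamping `clamp t = max(¼, min(t, ¾))` of `ℝ` onto `[¼, ¾]`
(the other bound `¼ ≤ clamp t` is `le_max_left`). [folklore] -/
theorem clampCore_le (t : ℝ) : max (1 / 4) (min t (3 / 4)) ≤ 3 / 4 :=
  max_le (by norm_num) (min_le_right _ _)

/-- `clamp t = t` on the core `[¼, ¾]`. [folklore] -/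
theorem clampCore_of_mem {t : ℝ} (h1 : 1 / 4 ≤ t) (h2 : t ≤ 3 / 4) :
    max (1 / 4) (min t (3 / 4)) = t := by
  rw [min_eq_left h2, max_eq_right h1]

/-- `clamp t = ¼` for `t ≤ ¼`. [folklore] -/
theorem clampCore_of_le {t : ℝ} (h : t ≤ 1 / 4) : max (1 / 4) (min t (3 / 4)) = 1 / 4 := by
  rw [min_eq_left (h.trans (by norm_num)), max_eq_left h]

/-- `clamp t = ¾` for `¾ ≤ t`. [folklore] -/
theorem clampCore_of_ge {t : ℝ} (h : 3 / 4 ≤ t) : max (1 / 4) (min t (3 / 4)) = 3 / 4 := by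
  rw [min_eq_right h, max_eq_right (by norm_num)]

/-- `clamp` is continuous. [folklore] -/
theorem continuous_clampCore : Continuous fun t : ℝ => max (1 / 4) (min t (3 / 4)) :=
  continuous_const.max (continuous_id.min continuous_const)

/-- The straight-line deformation `(1 - s)t + s·clamp(t)` of the fat arc onto its core stays in
the fat arc. [folklore] -/
theorem deform_mem_fatArc (s : I) (t : ↥(Icc (1 / 8 : ℝ) (7 / 8))) :
    (1 - (s : ℝ)) * (t : ℝ) + (s : ℝ) * max (1 / 4) (min (t : ℝ) (3 / 4)) ∈
      Icc (1 / 8 : ℝ) (7 / 8) := by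
  have hs0 : 0 ≤ (s : ℝ) := s.2.1
  have hs1 : (s : ℝ) ≤ 1 := s.2.2
  have ht1 : 1 / 8 ≤ (t : ℝ) := t.2.1
  have ht2 : (t : ℝ) ≤ 7 / 8 := t.2.2
  have hc1 : 1 / 4 ≤ max (1 / 4) (min (t : ℝ) (3 / 4)) := le_max_left _ _
  have hc2 := clampCore_le t
  constructor
  · nlinarith [mul_nonneg (sub_nonneg.2 hs1) (sub_nonneg.2 ht1), mul_nonneg hs0 (sub_nonneg.2 hc1)]
  · nlinarith [mul_nonneg (sub_nonneg.2 hs1) (sub_nonneg.2 ht2), mul_nonneg hs0 (sub_nonneg.2 hc2)]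

/-- **Retracting the collars**: the inclusion `([¼, ¾] × K, {¼, ¾} × K) ↪ ([⅛, ⅞] × K,
([⅛, ¼] ∪ [¾, ⅞]) × K)` of the core strip induces isomorphisms on relative homology, by the
deformation `H(s, (t, x)) = ((1 - s)t + s·clamp(t), x)` of the fat-arc strip onto its core strip,
which fixes the core and preserves the collars (Hatcher 2002, Prop. 2.19, in the form
`relativeSingularHomology.isIso_map_of_deformation`). [cite: HatcherAT2002, §2.1 Prop. 2.19] -/
theorem isIso_map_coreStrip (n : ℕ) :
    IsIso (relativeSingularHomology.map R M
      (subsetIncl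
        ((fun q => (q.1 : ℝ)) ⁻¹' Icc (1 / 4) (3 / 4) : Set (↥(Icc (1 / 8 : ℝ) (7 / 8)) × K)))
      (relativeSingularHomology.mapsTo_subsetIncl_preimage
        ((fun q => (q.1 : ℝ)) ⁻¹' Icc (1 / 4) (3 / 4) : Set (↥(Icc (1 / 8 : ℝ) (7 / 8)) × K))
        ((fun q => (q.1 : ℝ)) ⁻¹' (Iic (1 / 4) ∪ Ici (3 / 4)))) n) := by
  have hs : Continuous fun q : I × (↥(Icc (1 / 8 : ℝ) (7 / 8)) × K) => (q.1 : ℝ) :=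
    continuous_subtype_val.comp continuous_fst
  have ht : Continuous fun q : I × (↥(Icc (1 / 8 : ℝ) (7 / 8)) × K) => (q.2.1 : ℝ) :=
    continuous_subtype_val.comp (continuous_fst.comp continuous_snd)
  let H : C(I × (↥(Icc (1 / 8 : ℝ) (7 / 8)) × K), ↥(Icc (1 / 8 : ℝ) (7 / 8)) × K) :=
    ⟨fun q => (⟨(1 - (q.1 : ℝ)) * (q.2.1 : ℝ) + (q.1 : ℝ) * max (1 / 4) (min (q.2.1 : ℝ) (3 / 4)),
        deform_mem_fatArc q.1 q.2.1⟩, q.2.2),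
      ((((continuous_const.sub hs).mul ht).add (hs.mul (continuous_clampCore.comp ht))).subtype_mk
        _).prodMk (continuous_snd.comp continuous_snd)⟩
  have hH : ∀ (s : I) (q : ↥(Icc (1 / 8 : ℝ) (7 / 8)) × K), ((H (s, q)).1 : ℝ) =
      (1 - (s : ℝ)) * (q.1 : ℝ) + (s : ℝ) * max (1 / 4) (min (q.1 : ℝ) (3 / 4)) := fun s q => rfl
  refine relativeSingularHomology.isIso_map_of_deformation R M _ H ?_ ?_ ?_ ?_ n
  · -- `H₀ = 𝟙`
    intro q
    refine Prod.ext (Subtype.ext ?_) rfl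
    rw [hH]
    show (1 - (0 : ℝ)) * (q.1 : ℝ) + 0 * max (1 / 4) (min (q.1 : ℝ) (3 / 4)) = q.1
    ring
  · -- `H₁` lands in the core
    intro q
    show 1 / 4 ≤ ((H (1, q)).1 : ℝ) ∧ ((H (1, q)).1 : ℝ) ≤ 3 / 4
    rw [hH]
    have h : (1 - ((1 : I) : ℝ)) * (q.1 : ℝ) + ((1 : I) : ℝ) * max (1 / 4) (min (q.1 : ℝ) (3 / 4)) =
        max (1 / 4) (min (q.1 : ℝ) (3 / 4)) := by
      show (1 - (1 : ℝ)) * (q.1 : ℝ) + 1 * max (1 / 4) (min (q.1 : ℝ) (3 / 4)) = _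
      ring
    rw [h]
    exact ⟨le_max_left _ _, clampCore_le _⟩
  · -- `H_s = 𝟙` on the core
    intro s q hq
    refine Prod.ext (Subtype.ext ?_) rfl
    rw [hH, clampCore_of_mem hq.1 hq.2]
    ring
  · -- `H_s` preserves the collars
    intro s q hq
    have hs1 : (s : ℝ) ≤ 1 := s.2.2
    show ((H (s, q)).1 : ℝ) ≤ 1 / 4 ∨ 3 / 4 ≤ ((H (s, q)).1 : ℝ)
    rw [hH]
    rcases hq with h | h
    · left
      have h' : (q.1 : ℝ) ≤ 1 / 4 := h
      rw [clampCore_of_le h']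
      nlinarith [mul_nonneg (sub_nonneg.2 hs1) (sub_nonneg.2 h')]
    · right
      have h' : 3 / 4 ≤ (q.1 : ℝ) := h
      rw [clampCore_of_ge h']
      nlinarith [mul_nonneg (sub_nonneg.2 hs1) (sub_nonneg.2 h')]

/-- **The core strip is a cylinder**: a homeomorphism `[¼, ¾] × K ≅ I × K` (affine in the first
coordinate, Mathlib's `iccHomeoI`) carrying `{¼, ¾} × K` (the trace of the collars on the core)
onto `{0, 1} × K` and back. [folklore] -/
theorem exists_coreStripHomeomorph :
    ∃ Θ : ↥((fun q => (q.1 : ℝ)) ⁻¹' Icc (1 / 4) (3 / 4) : Set (↥(Icc (1 / 8 : ℝ) (7 / 8)) × K)) ≃ₜ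
        I × K,
      MapsTo Θ (Subtype.val ⁻¹' ((fun q => (q.1 : ℝ)) ⁻¹' (Iic (1 / 4) ∪ Ici (3 / 4))))
          (Prod.fst ⁻¹' ({0, 1} : Set I)) ∧
        MapsTo Θ.symm (Prod.fst ⁻¹' ({0, 1} : Set I))
          (Subtype.val ⁻¹' ((fun q => (q.1 : ℝ)) ⁻¹' (Iic (1 / 4) ∪ Ici (3 / 4)))) := by
  have hJ : ∀ {t : ℝ}, t ∈ Icc (1 / 4 : ℝ) (3 / 4) → t ∈ Icc (1 / 8 : ℝ) (7 / 8) :=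
    fun ht => ⟨by linarith [ht.1], by linarith [ht.2]⟩
  let ι : ↥(Icc (1 / 4 : ℝ) (3 / 4)) ≃ₜ I := iccHomeoI (1 / 4 : ℝ) (3 / 4) (by norm_num)
  have hι : ∀ t, ((ι t : I) : ℝ) = ((t : ℝ) - 1 / 4) / (3 / 4 - 1 / 4) := fun t => rfl
  have hι' : ∀ s,
      ((ι.symm s : ↥(Icc (1 / 4 : ℝ) (3 / 4))) : ℝ) = (3 / 4 - 1 / 4) * (s : ℝ) + 1 / 4 :=
    fun s => rfl
  let Θ : ↥((fun q => (q.1 : ℝ)) ⁻¹' Icc (1 / 4) (3 / 4) : Set (↥(Icc (1 / 8 : ℝ) (7 / 8)) × K)) ≃ₜ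
      I × K :=
    { toFun := fun q => (ι ⟨(q.1.1 : ℝ), q.2⟩, q.1.2)
      invFun := fun q => ⟨(⟨((ι.symm q.1 : ℝ)), hJ (ι.symm q.1).2⟩, q.2), (ι.symm q.1).2⟩
      left_inv := fun q => by
        refine Subtype.ext (Prod.ext (Subtype.ext ?_) rfl)
        show ((ι.symm (ι ⟨(q.1.1 : ℝ), q.2⟩) : ↥(Icc (1 / 4 : ℝ) (3 / 4))) : ℝ) = (q.1.1 : ℝ)
        rw [Homeomorph.symm_apply_apply]
      right_inv := fun q => Prod.ext (ι.apply_symm_apply q.1) rfl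
      continuous_toFun :=
        (ι.continuous.comp ((continuous_subtype_val.comp
          (continuous_fst.comp continuous_subtype_val)).subtype_mk _)).prodMk
          (continuous_snd.comp continuous_subtype_val)
      continuous_invFun :=
        (((continuous_subtype_val.comp (ι.symm.continuous.comp continuous_fst)).subtype_mk
            _).prodMk continuous_snd).subtype_mk _ }
  have hΘ : ∀ q, ((Θ q).1 : ℝ) = ((q.1.1 : ℝ) - 1 / 4) / (3 / 4 - 1 / 4) := fun q => hι _
  have hΘ' : ∀ q, (((Θ.symm q).1.1 : ℝ)) = (3 / 4 - 1 / 4) * (q.1 : ℝ) + 1 / 4 := fun q => hι' _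
  refine ⟨Θ, fun q hq => ?_, fun q hq => ?_⟩
  · have h1 : 1 / 4 ≤ (q.1.1 : ℝ) := q.2.1
    have h2 : (q.1.1 : ℝ) ≤ 3 / 4 := q.2.2
    show (Θ q).1 ∈ ({0, 1} : Set I)
    rcases hq with h | h
    · have h14 : (q.1.1 : ℝ) = 1 / 4 := le_antisymm h h1
      refine Or.inl (Subtype.ext ?_)
      rw [hΘ, h14]
      show ((1 / 4 : ℝ) - 1 / 4) / (3 / 4 - 1 / 4) = 0
      norm_num
    · have h34 : (q.1.1 : ℝ) = 3 / 4 := le_antisymm h2 h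
      refine Or.inr (Subtype.ext ?_)
      rw [hΘ, h34]
      show ((3 / 4 : ℝ) - 1 / 4) / (3 / 4 - 1 / 4) = 1
      norm_num
  · show ((Θ.symm q).1.1 : ℝ) ≤ 1 / 4 ∨ 3 / 4 ≤ ((Θ.symm q).1.1 : ℝ)
    rw [hΘ']
    rcases hq with h | h
    · left
      have h0 : ((q.1 : ℝ)) = 0 := by
        rw [h]
        rfl
      rw [h0]
      norm_num
    · right
      have h1 : ((q.1 : ℝ)) = 1 := by
        rw [mem_singleton_iff] at h
        rw [h]
        rfl
      rw [h1]
      norm_num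

/-- The closure of the thin strip lies in the interior of the quarter strip (the closed ⅛-arc lies
in the open ¼-arc): the excision hypothesis. [folklore] -/
theorem closure_thinStrip_subset_interior :
    closure (Prod.fst ⁻¹' ball (0 : AddCircle (1 : ℝ)) (1 / 8) : Set (AddCircle (1 : ℝ) × K)) ⊆
      interior (Prod.fst ⁻¹' closedBall (0 : AddCircle (1 : ℝ)) (1 / 4)) := by
  refine (closure_minimal (preimage_mono ball_subset_closedBall)
    (isClosed_closedBall.preimage continuous_fst)).trans ?_
  exact (preimage_mono (closedBall_subset_ball (by norm_num : (1 / 8 : ℝ) < 1 / 4))).trans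
    (interior_maximal (preimage_mono ball_subset_closedBall) (isOpen_ball.preimage continuous_fst))

/-- **`Hₙ(I × K, {0,1} × K) ≅ Hₙ(S¹ × K, D × K)`** for the closed arc `D ⊂ S¹ = ℝ/ℤ` of radius
`¼` around `0`: identify `(I, ∂I) × K` with the core `([¼, ¾], {¼, ¾}) × K` of the fat arc
`[⅛, ⅞]`; retract the collars `[⅛, ¼] ∪ [¾, ⅞]` onto the end points of the core (Prop. 2.19);
straighten `[⅛, ⅞] × K ≅ (S¹ ∖ B) × K` with `B` the open arc of radius `⅛` around `0`, the
collars going to `(D ∖ B) × K`; and excise `B × K` from `(S¹ × K, D × K)` (Thm. 2.20,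
`closure B ⊆ interior D`). [cite: HatcherAT2002, §2.1 Prop. 2.19 and Thm. 2.20] -/
theorem relativeSingularHomology.nonempty_circlePairIso (n : ℕ) :
    Nonempty (relativeSingularHomology R M (I × K) (Prod.fst ⁻¹' ({0, 1} : Set I)) n ≅
      relativeSingularHomology R M (AddCircle (1 : ℝ) × K)
        (Prod.fst ⁻¹' closedBall (0 : AddCircle (1 : ℝ)) (1 / 4)) n) := by
  obtain ⟨Θ, hΘ, hΘ'⟩ := exists_coreStripHomeomorph (K := K)
  obtain ⟨Φ, hΦ, hΦ'⟩ := exists_fatArcStripHomeomorph (K := K)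
  -- `(I, ∂I) × K ≅ (core strip, its trace of the collars)`
  let e₁ := relativeSingularHomology.mapHomeomorph R M Θ.symm hΘ' (fun q hq => hΘ hq) n
  -- `(core strip, trace) → (fat-arc strip, collar strip)`: the deformation
  haveI := isIso_map_coreStrip R M (K := K) n
  let e₂ := asIso (relativeSingularHomology.map R M
    (subsetIncl
      ((fun q => (q.1 : ℝ)) ⁻¹' Icc (1 / 4) (3 / 4) : Set (↥(Icc (1 / 8 : ℝ) (7 / 8)) × K)))
    (relativeSingularHomology.mapsTo_subsetIncl_preimage
      ((fun q => (q.1 : ℝ)) ⁻¹' Icc (1 / 4) (3 / 4) : Set (↥(Icc (1 / 8 : ℝ) (7 / 8)) × K))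
      ((fun q => (q.1 : ℝ)) ⁻¹' (Iic (1 / 4) ∪ Ici (3 / 4)))) n)
  -- `(fat-arc strip, collar strip) ≅ ((S¹ ∖ B) × K, (D ∖ B) × K)`: the straightening
  let e₃ := relativeSingularHomology.mapHomeomorph R M Φ hΦ hΦ' n
  -- excision of `B × K` from `(S¹ × K, D × K)`
  haveI := relativeSingularHomology.isIso_map_of_closure_subset_interior_holds R M
    (AddCircle (1 : ℝ) × K) (closure_thinStrip_subset_interior (K := K)) n
  let e₄ := asIso (relativeSingularHomology.map R M
    (X := ↥(Prod.fst ⁻¹' ball (0 : AddCircle (1 : ℝ)) (1 / 8) : Set (AddCircle (1 : ℝ) × K))ᶜ)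
    (subsetIncl (Prod.fst ⁻¹' ball (0 : AddCircle (1 : ℝ)) (1 / 8) : Set (AddCircle (1 : ℝ) × K))ᶜ)
    (mapsTo_preimage Subtype.val
      (Prod.fst ⁻¹' closedBall (0 : AddCircle (1 : ℝ)) (1 / 4) : Set (AddCircle (1 : ℝ) × K))) n)
  exact ⟨e₁ ≪≫ e₂ ≪≫ e₃ ≪≫ e₄⟩

/-- The quarter strip `D × K` (`D` the closed arc of radius `¼` around `0`) is a cylinder
`I × K`. [folklore] -/
theorem nonempty_quarterArcStripHomeomorph :
    Nonempty (I × K ≃ₜ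
      ↥(Prod.fst ⁻¹' closedBall (0 : AddCircle (1 : ℝ)) (1 / 4) :
        Set (AddCircle (1 : ℝ) × K))) := by
  obtain ⟨arc, -⟩ := exists_arcHomeomorph 0 (1 / 4) (by norm_num)
  let strip : ↥(Prod.fst ⁻¹' closedBall (((0 : ℝ)) : AddCircle (1 : ℝ)) (1 / 4) :
        Set (AddCircle (1 : ℝ) × K)) ≃ₜ ↥(closedBall (((0 : ℝ)) : AddCircle (1 : ℝ)) (1 / 4)) × K :=
    { toFun := fun q => (⟨q.1.1, q.2⟩, q.1.2)
      invFun := fun q => ⟨(q.1.1, q.2), q.1.2⟩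
      left_inv := fun _ => rfl
      right_inv := fun _ => rfl
      continuous_toFun := ((continuous_fst.comp continuous_subtype_val).subtype_mk _).prodMk
        (continuous_snd.comp continuous_subtype_val)
      continuous_invFun :=
        ((continuous_subtype_val.comp continuous_fst).prodMk continuous_snd).subtype_mk _ }
  exact ⟨(((iccHomeoI (0 - 1 / 4 : ℝ) (0 + 1 / 4) (by norm_num)).symm.prodCongr
    (Homeomorph.refl K)).trans (arc.prodCongr (Homeomorph.refl K))).trans
    (strip.symm.trans (Homeomorph.setCongr (by rw [QuotientAddGroup.mk_zero])))⟩

end CirclePair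

/-! ### §3 `χ(S¹ × K) = 0` -/

section Circle

variable (R : Type v) [CommRing R] (M : Type v) [AddCommGroup M] [Module R M]
variable {K : Type u} [TopologicalSpace K]
variable [IsNoetherianRing R] [HasRankNullity.{max u v} R]

/-- **`χ(S¹ × K) = 0`, with finiteness** (`S¹ = ℝ/ℤ = AddCircle 1`): if `H_•(K; M)` is finitely
generated and zero from degree `N` on, then `H_•(S¹ × K; M)` is finitely generated, zero from
degree `N + 1` on, and `χ(S¹ × K) = 0`.  Exact sequence of the pair `(S¹ × K, D × K)` for a closed
arc `D`: `χ(S¹ × K) = χ(D × K) + χ(S¹ × K, D × K)` (Hatcher 2002, p. 118 and Thm. 2.44), where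
`D × K ≅ I × K` has `χ = χ(K)` (`FinRelHomology.unitInterval_prod`) and `(S¹ × K, D × K)` has the
homology of `(I, ∂I) × K`, of Euler characteristic `-χ(K)`
(`relativeSingularHomology.nonempty_circlePairIso`, `FinRelHomology.prod_unitInterval`).  This is
`χ(K × S¹) = χ(K)χ(S¹)` (Spanier 1981, Ch. 9, Sec. 3, Thm. 1, trivial bundle) without the Künneth
formula. [cite: HatcherAT2002, §2.1 p. 118, §2.2 Thm. 2.44]
[cite: Spanier1981, Ch. 9, Sec. 3, Thm. 1] -/
theorem FinRelHomology.addCircle_prod {N : ℕ} (h : FinRelHomology R M K ∅ N) :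
    FinRelHomology R M (AddCircle (1 : ℝ) × K) ∅ (N + 1) ∧
      relEuler R M (AddCircle (1 : ℝ) × K) ∅ = 0 := by
  haveI : Nontrivial R := nontrivial_of_hasRankNullity.{max u v} R
  -- the relative term `(S¹ × K, D × K) ~ (I, ∂I) × K`
  obtain ⟨hI, hχI⟩ := FinRelHomology.prod_unitInterval R M h
  have hset : (Prod.fst ⁻¹' ({0, 1} : Set I) ∪ Prod.snd ⁻¹' (∅ : Set K) : Set (I × K)) =
      Prod.fst ⁻¹' ({0, 1} : Set I) := by
    rw [Set.preimage_empty, Set.union_empty]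
  have iso := fun k => (relativeSingularHomology.nonempty_circlePairIso R M (K := K) k).some
  have hXA : FinRelHomology R M (AddCircle (1 : ℝ) × K)
      (Prod.fst ⁻¹' closedBall (0 : AddCircle (1 : ℝ)) (1 / 4) : Set (AddCircle (1 : ℝ) × K))
      (N + 1) :=
    (hI.congr_set hset).of_iso iso
  have hχXA : relEuler R M (AddCircle (1 : ℝ) × K)
      (Prod.fst ⁻¹' closedBall (0 : AddCircle (1 : ℝ)) (1 / 4) : Set (AddCircle (1 : ℝ) × K)) =
      -relEuler R M K ∅ := by
    rw [← relEuler_eq_of_iso iso, ← relEuler_congr_set hset, hχI]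
  -- the subspace term `D × K ≅ I × K`
  obtain ⟨hIK, hχIK⟩ := FinRelHomology.unitInterval_prod R M h
  obtain ⟨e⟩ := nonempty_quarterArcStripHomeomorph (K := K)
  have hAB : FinRelHomology R M
      (↥(Prod.fst ⁻¹' closedBall (0 : AddCircle (1 : ℝ)) (1 / 4) : Set (AddCircle (1 : ℝ) × K)))
      (Subtype.val ⁻¹' (∅ : Set (AddCircle (1 : ℝ) × K))) (N + 1) :=
    (hIK.of_homeomorph e (fun _ hx => False.elim hx) (fun _ hx => False.elim hx)).mono
      (Nat.le_succ N)
  have hχAB : relEuler R M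
      (↥(Prod.fst ⁻¹' closedBall (0 : AddCircle (1 : ℝ)) (1 / 4) : Set (AddCircle (1 : ℝ) × K)))
      (Subtype.val ⁻¹' (∅ : Set (AddCircle (1 : ℝ) × K))) = relEuler R M K ∅ := by
    rw [← hχIK]
    exact (relEuler_eq_of_homeomorph (R := R) (M := M) (A := (∅ : Set (I × K))) e
      (fun _ hx => False.elim hx) (fun _ hx => False.elim hx)).symm
  obtain ⟨hX, hχ⟩ := FinRelHomology.triple_mid (Set.empty_subset _) hAB hXA
  refine ⟨hX, ?_⟩
  rw [hχ, hχXA, hχAB]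
  ring

/-- **`χ(K × S¹) = 0`, with finiteness** — `FinRelHomology.addCircle_prod` with the factors
swapped. [cite: HatcherAT2002, §2.1 p. 118, §2.2 Thm. 2.44] -/
theorem FinRelHomology.prod_addCircle {N : ℕ} (h : FinRelHomology R M K ∅ N) :
    FinRelHomology R M (K × AddCircle (1 : ℝ)) ∅ (N + 1) ∧
      relEuler R M (K × AddCircle (1 : ℝ)) ∅ = 0 := by
  obtain ⟨h1, h2⟩ := FinRelHomology.addCircle_prod R M h
  refine ⟨h1.of_homeomorph (Homeomorph.prodComm (AddCircle (1 : ℝ)) K) (fun _ hx => False.elim hx)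
    (fun _ hx => False.elim hx), ?_⟩
  rw [← h2]
  exact (relEuler_eq_of_homeomorph (R := R) (M := M) (A := (∅ : Set (AddCircle (1 : ℝ) × K)))
    (Homeomorph.prodComm (AddCircle (1 : ℝ)) K) (fun _ hx => False.elim hx)
    (fun _ hx => False.elim hx)).symm

/-- **`χ(ℝ/pℤ × K) = 0`, with finiteness, for every period `p ≠ 0`** (all the circles
`AddCircle p` are homeomorphic: Mathlib's `AddCircle.homeomorphAddCircle`).
[cite: HatcherAT2002, §2.1 p. 118, §2.2 Thm. 2.44] -/
theorem FinRelHomology.addCircle_prod_of_ne_zero {p : ℝ} (hp : p ≠ 0) {N : ℕ}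
    (h : FinRelHomology R M K ∅ N) :
    FinRelHomology R M (AddCircle p × K) ∅ (N + 1) ∧ relEuler R M (AddCircle p × K) ∅ = 0 := by
  obtain ⟨h1, h2⟩ := FinRelHomology.addCircle_prod R M h
  let e : AddCircle (1 : ℝ) × K ≃ₜ AddCircle p × K :=
    (AddCircle.homeomorphAddCircle (1 : ℝ) p one_ne_zero hp).prodCongr (Homeomorph.refl K)
  refine ⟨h1.of_homeomorph e (fun _ hx => False.elim hx) (fun _ hx => False.elim hx), ?_⟩
  rw [← h2]
  exact (relEuler_eq_of_homeomorph (R := R) (M := M) (A := (∅ : Set (AddCircle (1 : ℝ) × K))) e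
    (fun _ hx => False.elim hx) (fun _ hx => False.elim hx)).symm

end Circle

/-! ### §4 `χ(S¹) = 0`, `χ(T²) = 0`, `χ(K × T²) = 0` -/

section Tori

variable (R : Type v) [CommRing R] (M : Type v) [AddCommGroup M] [Module R M]
variable [IsNoetherianRing R]

/-- **`χ(S¹) = 0`, with finiteness**: the homology of the circle `ℝ/ℤ` with coefficients in a
finitely generated module `M` is finitely generated, zero from degree `2` on, and has Euler
characteristic `0` (`S¹ = S¹ × point`, `FinRelHomology.addCircle_prod`, the point being
contractible: `finRelHomology_empty_of_contractibleSpace`; Hatcher 2002, §2.2, Example 2.37 /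
Thm. 2.44). [cite: HatcherAT2002, §2.2 Thm. 2.44] -/
theorem FinRelHomology.unitAddCircle [HasRankNullity.{v} R] [Module.Finite R M] :
    FinRelHomology R M (AddCircle (1 : ℝ)) ∅ 2 ∧ relEuler R M (AddCircle (1 : ℝ)) ∅ = 0 := by
  have hpt : FinRelHomology R M PUnit.{1} ∅ 1 := finRelHomology_empty_of_contractibleSpace R M
  obtain ⟨h1, h2⟩ := FinRelHomology.addCircle_prod R M hpt
  refine ⟨h1.of_homeomorph (Homeomorph.prodPUnit (AddCircle (1 : ℝ))) (fun _ hx => False.elim hx)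
    (fun _ hx => False.elim hx), ?_⟩
  rw [← h2]
  exact (relEuler_eq_of_homeomorph (R := R) (M := M)
    (A := (∅ : Set (AddCircle (1 : ℝ) × PUnit.{1})))
    (Homeomorph.prodPUnit (AddCircle (1 : ℝ))) (fun _ hx => False.elim hx)
    (fun _ hx => False.elim hx)).symm

/-- **`χ(T²) = 0`, with finiteness**, for the torus `T² = ℝ/ℤ × ℝ/ℤ`: finitely generated homology,
zero from degree `3` on, Euler characteristic `0`. [cite: HatcherAT2002, §2.2 Thm. 2.44] -/
theorem FinRelHomology.unitAddCircle_prod_unitAddCircle [HasRankNullity.{v} R]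
    [Module.Finite R M] :
    FinRelHomology R M (AddCircle (1 : ℝ) × AddCircle (1 : ℝ)) ∅ 3 ∧
      relEuler R M (AddCircle (1 : ℝ) × AddCircle (1 : ℝ)) ∅ = 0 :=
  FinRelHomology.addCircle_prod R M (FinRelHomology.unitAddCircle R M).1

variable {K : Type u} [TopologicalSpace K] [HasRankNullity.{max u v} R]

/-- **`χ(K × T²) = 0`, with finiteness** — e.g. `e(Σ_g × T²) = 0` for the products of a surface
with the torus from which the manifolds `Y_g(…)` of Akhmedov–Park 2010 are surgered: if
`H_•(K; M)` is finitely generated and zero from degree `N` on, then so is `H_•(K × T²; M)` from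
degree `N + 2` on, and `χ(K × T²) = 0`. [cite: HatcherAT2002, §2.2 Thm. 2.44] -/
theorem FinRelHomology.prod_torus {N : ℕ} (h : FinRelHomology R M K ∅ N) :
    FinRelHomology R M (K × (AddCircle (1 : ℝ) × AddCircle (1 : ℝ))) ∅ (N + 2) ∧
      relEuler R M (K × (AddCircle (1 : ℝ) × AddCircle (1 : ℝ))) ∅ = 0 := by
  obtain ⟨h1, -⟩ := FinRelHomology.prod_addCircle R M h
  obtain ⟨h2, hχ⟩ := FinRelHomology.prod_addCircle R M h1
  let e : (K × AddCircle (1 : ℝ)) × AddCircle (1 : ℝ) ≃ₜ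
      K × (AddCircle (1 : ℝ) × AddCircle (1 : ℝ)) :=
    Homeomorph.prodAssoc K (AddCircle (1 : ℝ)) (AddCircle (1 : ℝ))
  refine ⟨h2.of_homeomorph e (fun _ hx => False.elim hx) (fun _ hx => False.elim hx), ?_⟩
  rw [← hχ]
  exact (relEuler_eq_of_homeomorph (R := R) (M := M)
    (A := (∅ : Set ((K × AddCircle (1 : ℝ)) × AddCircle (1 : ℝ)))) e (fun _ hx => False.elim hx)
    (fun _ hx => False.elim hx)).symm

end Tori

/-! ### Products with a closed ball: `χ(K × B̄) = χ(K)` -/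

section ClosedBall

variable (R : Type v) [CommRing R] (M : Type v) [AddCommGroup M] [Module R M]
variable {K : Type u} [TopologicalSpace K] {E : Type u} [NormedAddCommGroup E] [NormedSpace ℝ E]

/-- **`K × B̄(0, r)` is homotopy equivalent to `K`** (`r ≥ 0`): the projection, with homotopy
inverse `k ↦ (k, 0)` and the straight-line homotopy `(t, (k, v)) ↦ (k, t v)` inside the convex
ball (Hatcher 2002, Ch. 0, p. 3 and Example 0.10). [cite: HatcherAT2002, Ch. 0 p. 3] -/
theorem nonempty_homotopyEquiv_prod_closedBall {r : ℝ} (hr : 0 ≤ r) :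
    Nonempty (ContinuousMap.HomotopyEquiv (K × ↥(Metric.closedBall (0 : E) r)) K) := by
  let z : ↥(Metric.closedBall (0 : E) r) := ⟨0, Metric.mem_closedBall_self hr⟩
  let f : C(K × ↥(Metric.closedBall (0 : E) r), K) := ⟨Prod.fst, continuous_fst⟩
  let g : C(K, K × ↥(Metric.closedBall (0 : E) r)) := ⟨fun k => (k, z), by fun_prop⟩
  have hmem : ∀ (t : I) (v : ↥(Metric.closedBall (0 : E) r)),
      (t : ℝ) • (v : E) ∈ Metric.closedBall (0 : E) r := fun t v => by
    have hv : ‖(v : E)‖ ≤ r := mem_closedBall_zero_iff.1 v.2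
    rw [mem_closedBall_zero_iff, norm_smul, Real.norm_of_nonneg t.2.1]
    calc (t : ℝ) * ‖(v : E)‖ ≤ 1 * ‖(v : E)‖ := by gcongr; exact t.2.2
      _ = ‖(v : E)‖ := one_mul _
      _ ≤ r := hv
  let H : ContinuousMap.Homotopy (g.comp f) (ContinuousMap.id _) :=
    { toFun := fun p => (p.2.1, ⟨(p.1 : ℝ) • (p.2.2 : E), hmem p.1 p.2.2⟩)
      continuous_toFun := by
        refine (continuous_fst.comp continuous_snd).prodMk ?_
        exact ((continuous_subtype_val.comp continuous_fst).smul
          (continuous_subtype_val.comp (continuous_snd.comp continuous_snd))).subtype_mk _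
      map_zero_left := fun p => by
        ext
        · rfl
        · simp only [ContinuousMap.comp_apply]
          show (((0 : I) : ℝ) • (p.2 : E)) = ((g (f p)).2 : E)
          simp [g, z]
      map_one_left := fun p => by
        ext
        · rfl
        · show (((1 : I) : ℝ) • (p.2 : E)) = (p.2 : E)
          simp }
  exact ⟨{ toFun := f
           invFun := g
           left_inv := ⟨H⟩
           right_inv := ContinuousMap.Homotopic.refl _ }⟩

/-- **`H_•(K × B̄(0, r))` is finitely generated and bounded like `H_•(K)`, and
`χ(K × B̄(0, r)) = χ(K)`** (`r ≥ 0`; homotopy invariance along `K × B̄ ≃ K`, Hatcher 2002,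
Cor. 2.11) — e.g. the closed tubular piece `Σ × D²` of a surface in a `4`-manifold has
`χ = χ(Σ)`. [cite: HatcherAT2002, §2.1 Cor. 2.11] -/
theorem FinRelHomology.prod_closedBall {r : ℝ} (hr : 0 ≤ r) {N : ℕ}
    (h : FinRelHomology R M K ∅ N) :
    FinRelHomology R M (K × ↥(Metric.closedBall (0 : E) r)) ∅ N ∧
      relEuler R M (K × ↥(Metric.closedBall (0 : E) r)) ∅ = relEuler R M K ∅ := by
  obtain ⟨e⟩ := nonempty_homotopyEquiv_prod_closedBall (K := K) (E := E) hr
  let ι : ∀ k, relativeSingularHomology R M K ∅ k ≅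
      relativeSingularHomology R M (K × ↥(Metric.closedBall (0 : E) r)) ∅ k := fun k =>
    (relativeSingularHomology.emptyIso R M K k).symm ≪≫
      (singularHomology.isoOfHomotopyEquiv R M e k).symm ≪≫
        relativeSingularHomology.emptyIso R M (K × ↥(Metric.closedBall (0 : E) r)) k
  exact ⟨h.of_iso ι, (relEuler_eq_of_iso ι).symm⟩

end ClosedBall

end Literature.AlgebraicTopology.SingularHomology
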